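import Mathlib.LinearAlgebra.Matrix.Charpoly.FiniteField
import Literature.NumberTheory.FaltingsSerre.Deviation

/-!
# The Faltings–Serre method after BPPTVY, I bis: free test elements — powers, complex conjugation, second coefficient

Notation of `Literature/NumberTheory/FaltingsSerre/Deviation.lean` ([BPPTVY] = Brumer–Pacetti–Poor–Tornaría–
Voight–Yuen, ANT **13** (2019) [cite: BrumerEtAl2019], §2.3): a group `Γ`, a commutative ring `k`,
`ρ̄ : Γ →* GL_n(k)`, a deviation cocycle `μ` (`μ(στ) = μ(σ) + ρ̄(σ)μ(τ)ρ̄(σ)⁻¹`, (2.3.2)), the map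
`φ_μ(σ) = (ρ̄σ, μ(σ)ρ̄σ; 0, ρ̄σ)` (2.3.13) and its upper trace `utr φ_μ(σ) = tr(μ(σ)ρ̄(σ))` (2.3.15), whose
non-vanishing defines the OBSTRUCTING ELEMENTS of Def. 2.3.18.

PROVED here (elementary matrix algebra, not stated in [BPPTVY]; recorded because a Faltings–Serre certificate
may put POWERS of Frobenius elements and complex conjugation into the test set `T` of Algorithm 2.4.1 — whose
`traces` obligation `tr ρ₁(Frob_p^m) = tr ρ₂(Frob_p^m)` is discharged by `a_p = 0` for odd `m`, or by equality
of the full Euler factors at `p`, and at `c` by oddness — and may use the second characteristic-polynomial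
coefficient `b_p` where the full Euler factor is known; source of the use case: the paramodular certificate
factory's Galois-side report `pub-paramod-eng1-g7/NECESSITY-67.md`):

* `IsDeviationCocycle.trace_apply_pow_mul_pow_add` — `tr(μ(σ^m) ρ̄(σ)^{m+j}) = m · tr(μ(σ) ρ̄(σ)^{m+j})`
  (from `μ(σ^m) = Σ_{i<m} ρ̄(σ)^i μ(σ) ρ̄(σ)^{-i}`, proved by induction without writing the sum);
* `IsDeviationCocycle.trace_apply_pow` / `utr_extensionMap_pow` — `utr φ_μ(σ^m) = m · tr(μ(σ) ρ̄(σ)^m)`;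
* `isObstructingElt_pow_iff` — if `m` is a unit of `k`: `σ^m` is obstructing iff `tr(μ(σ) ρ̄(σ)^m) ≠ 0`;
  `not_isObstructingElt_pow` — if `m = 0` in `k`, `σ^m` is never obstructing;
* over `𝔽₂` (the case `ℓ = 2` of [BPPTVY, §§4–7]): even powers never obstruct
  (`not_isObstructingElt_pow_of_even`), and for odd `m`, `σ^m` obstructs iff `tr(μ(σ) ρ̄(σ)^m) ≠ 0`
  (`isObstructingElt_pow_iff_of_odd`).

* `two_mul_trace_eq_zero_of_involutive_similitude_neg` / `trace_eq_zero_of_involutive_similitude_neg` /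
  `trace_eq_trace_of_involutive_similitude_neg` — an involution that is a similitude with multiplier `-1` of an
  invertible form has `2 tr = 0` (trace `0` when `2` is a non-zero-divisor): complex conjugation is a FREE test
  element for two odd symplectic representations with the same multiplier.

* `trace_sq_one_add_smul_mul`, `four_mul_mul_eq_zero_of_trace_sq_eq`, `trace_mul_sq_add_eq_zero_of_trace_sq_eq`,
  `trace_mul_sq_eq_zero_of_residual` — the SECOND-COEFFICIENT test (`ℓ = 2`): in a stage
  `ρ₁(σ) = (1 + 2^r M_σ)ρ₂(σ)`, `tr ρ₁(σ²) - tr ρ₂(σ²) = 2^{r+1} tr(M g²) + 2^{2r} tr((Mg)²)`, so equality of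
  the characteristic polynomials at `σ` forces `tr(μ(σ)ρ̄(σ)²) = 0` (for `r = 1` via `tr X² = (tr X)²` over `𝔽₂`).

NOT here: the wiring of these tests into a variant of the criterion `Criterion.traceEq_of_faltingsSerre_symplectic`
(a `complete` binder allowing powers / second coefficients and the matching `traces` obligations) — that is
`CriterionProofs`-level bookkeeping; and anything Galois-theoretic.
-/

namespace Literature.NumberTheory.FaltingsSerre

open Matrix

section Powers

variable {Γ : Type*} [Group Γ] {n : Type*} [Fintype n] [DecidableEq n] {k : Type*} [CommRing k]

/-- For a deviation cocycle `μ` of `ρ̄` and `m, j ∈ ℕ`: `tr(μ(σ^m) ρ̄(σ)^{m+j}) = m · tr(μ(σ) ρ̄(σ)^{m+j})`.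
(Induction on `m`: `μ(σ^{m+1}) = μ(σ^m) + ρ̄(σ)^m μ(σ) ρ̄(σ)^{-m}` by the cocycle identity [BPPTVY, (2.3.2)],
and `tr(ρ̄(σ)^m μ(σ) ρ̄(σ)^{1+j}) = tr(μ(σ) ρ̄(σ)^{m+1+j})` by cyclicity of the trace.) [folklore] -/
theorem IsDeviationCocycle.trace_apply_pow_mul_pow_add {ρbar : Γ →* GL n k} {μ : Γ → Matrix n n k}
    (hμ : IsDeviationCocycle ρbar μ) (σ : Γ) (m j : ℕ) :
    Matrix.trace (μ (σ ^ m) * ((ρbar σ : GL n k) : Matrix n n k) ^ (m + j)) =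
      (m : k) * Matrix.trace (μ σ * ((ρbar σ : GL n k) : Matrix n n k) ^ (m + j)) := by
  induction m generalizing j with
  | zero =>
    rw [pow_zero, hμ.apply_one, Matrix.zero_mul, Matrix.trace_zero, Nat.cast_zero, zero_mul]
  | succ m ih =>
    set g : Matrix n n k := ((ρbar σ : GL n k) : Matrix n n k) with hg
    have hGm : ((ρbar (σ ^ m) : GL n k) : Matrix n n k) = g ^ m := by
      rw [map_pow, Units.val_pow_eq_pow_val]
    have hinv : (((ρbar (σ ^ m))⁻¹ : GL n k) : Matrix n n k) * g ^ m = 1 := by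
      rw [← hGm, Units.inv_mul]
    have h1 : μ (σ ^ (m + 1)) = μ (σ ^ m) + ((ρbar (σ ^ m) : GL n k) : Matrix n n k) * μ σ *
        (((ρbar (σ ^ m))⁻¹ : GL n k) : Matrix n n k) := by
      rw [pow_succ]; exact hμ (σ ^ m) σ
    have key : μ (σ ^ (m + 1)) * g ^ (m + 1 + j) =
        μ (σ ^ m) * g ^ (m + (j + 1)) + g ^ m * (μ σ * g ^ (1 + j)) := by
      rw [h1, hGm, Matrix.add_mul]
      congr 1
      · rw [show m + 1 + j = m + (j + 1) by omega]
      · rw [show m + 1 + j = m + (1 + j) by omega, pow_add, Matrix.mul_assoc, Matrix.mul_assoc,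
          ← Matrix.mul_assoc (((ρbar (σ ^ m))⁻¹ : GL n k) : Matrix n n k), hinv, Matrix.one_mul]
    rw [key, Matrix.trace_add, ih (j + 1), Matrix.trace_mul_comm (g ^ m), Matrix.mul_assoc, ← pow_add,
      show 1 + j + m = m + 1 + j by omega, show m + (j + 1) = m + 1 + j by omega, Nat.cast_succ]
    ring

/-- `tr(μ(σ^m) ρ̄(σ^m)) = m · tr(μ(σ) ρ̄(σ)^m)` — the quantity `utr φ_μ(σ^m)` of [BPPTVY, (2.3.15)] at a power,
in terms of `σ`. [folklore] -/
theorem IsDeviationCocycle.trace_apply_pow {ρbar : Γ →* GL n k} {μ : Γ → Matrix n n k}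
    (hμ : IsDeviationCocycle ρbar μ) (σ : Γ) (m : ℕ) :
    Matrix.trace (μ (σ ^ m) * ((ρbar (σ ^ m) : GL n k) : Matrix n n k)) =
      (m : k) * Matrix.trace (μ σ * ((ρbar σ : GL n k) : Matrix n n k) ^ m) := by
  have h := hμ.trace_apply_pow_mul_pow_add σ m 0
  rw [add_zero] at h
  rw [map_pow, Units.val_pow_eq_pow_val, h]

/-- `utr φ_μ(σ^m) = m · tr(μ(σ) ρ̄(σ)^m)`: the upper trace [BPPTVY, Lemma 2.3.11 / (2.3.15)] of `φ_μ` at a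
power of `σ`. [folklore] -/
theorem utr_extensionMap_pow {ρbar : Γ →* GL n k} {μ : Γ → Matrix n n k}
    (hμ : IsDeviationCocycle ρbar μ) (σ : Γ) (m : ℕ) :
    utr (extensionMap ρbar μ (σ ^ m)) = (m : k) * Matrix.trace (μ σ * ((ρbar σ : GL n k) : Matrix n n k) ^ m) := by
  rw [utr_extensionMap, hμ.trace_apply_pow]

/-- If `m` is a unit of `k`, then `σ^m` is an obstructing element for `μ` [BPPTVY, Def. 2.3.18] iff
`tr(μ(σ) ρ̄(σ)^m) ≠ 0` — a condition on `σ` alone, i.e. a class function of `φ_μ(σ)`. [folklore] -/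
theorem isObstructingElt_pow_iff {ρbar : Γ →* GL n k} {μ : Γ → Matrix n n k}
    (hμ : IsDeviationCocycle ρbar μ) (σ : Γ) {m : ℕ} (hm : IsUnit (m : k)) :
    IsObstructingElt ρbar μ (σ ^ m) ↔ Matrix.trace (μ σ * ((ρbar σ : GL n k) : Matrix n n k) ^ m) ≠ 0 := by
  unfold IsObstructingElt
  rw [hμ.trace_apply_pow, ne_eq, hm.mul_right_eq_zero]

/-- If `m = 0` in `k` (e.g. `ℓ ∣ m` over `𝔽_ℓ`), then `σ^m` is never an obstructing element: powers divisible
by the characteristic carry no information for the test of [BPPTVY, Algorithm 2.4.1, Step 4]. [folklore] -/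
theorem not_isObstructingElt_pow {ρbar : Γ →* GL n k} {μ : Γ → Matrix n n k}
    (hμ : IsDeviationCocycle ρbar μ) (σ : Γ) {m : ℕ} (hm : (m : k) = 0) :
    ¬ IsObstructingElt ρbar μ (σ ^ m) := by
  unfold IsObstructingElt
  rw [hμ.trace_apply_pow, hm, zero_mul]
  exact fun h => h rfl

end Powers

section CharTwo

variable {Γ : Type*} [Group Γ] {n : Type*} [Fintype n] [DecidableEq n]

/-- Over `𝔽₂` (the setting `ℓ = 2` of [BPPTVY, §§4–7]): an EVEN power of any element is never obstructing.
[folklore] -/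
theorem not_isObstructingElt_pow_of_even {ρbar : Γ →* GL n (ZMod 2)} {μ : Γ → Matrix n n (ZMod 2)}
    (hμ : IsDeviationCocycle ρbar μ) (σ : Γ) {m : ℕ} (hm : Even m) :
    ¬ IsObstructingElt ρbar μ (σ ^ m) :=
  not_isObstructingElt_pow hμ σ ((ZMod.natCast_eq_zero_iff_even).mpr hm)

/-- Over `𝔽₂`: for ODD `m`, `σ^m` is obstructing iff `tr(μ(σ) ρ̄(σ)^m) ≠ 0`.  (Use: with `σ = Frob_p` and
`a_p = 0` on both sides, every odd power sum of Frobenius eigenvalues vanishes, so `Frob_p^m` may join the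
test set `T` at no cost on the automorphic side.) [folklore] -/
theorem isObstructingElt_pow_iff_of_odd {ρbar : Γ →* GL n (ZMod 2)} {μ : Γ → Matrix n n (ZMod 2)}
    (hμ : IsDeviationCocycle ρbar μ) (σ : Γ) {m : ℕ} (hm : Odd m) :
    IsObstructingElt ρbar μ (σ ^ m) ↔
      Matrix.trace (μ σ * ((ρbar σ : GL n (ZMod 2)) : Matrix n n (ZMod 2)) ^ m) ≠ 0 :=
  isObstructingElt_pow_iff hμ σ (by rw [(ZMod.natCast_eq_one_iff_odd).mpr hm]; exact isUnit_one)

end CharTwo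

section SecondCoefficient

variable {n : Type*} [Fintype n] [DecidableEq n] {R : Type*} [CommRing R]

/-- The exact expansion behind the SECOND-COEFFICIENT test: for a scalar `t` and matrices `M, g`,
`tr(((1 + tM)g)²) = tr(g²) + 2t·tr(M g²) + t²·tr((Mg)²)` (expand and use `tr(gMg) = tr(Mg²)`).
In a Faltings–Serre stage `ρ₁(σ) = (1 + ℓ^r M_σ) ρ₂(σ)` ([BPPTVY, (2.3.5)], exact over `ℤ_ℓ` after
conjugation as in `CriterionProofs.lean`), this computes `tr ρ₁(σ²) - tr ρ₂(σ²)`. [folklore] -/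
theorem trace_sq_one_add_smul_mul (t : R) (M g : Matrix n n R) :
    Matrix.trace (((1 + t • M) * g) ^ 2) =
      Matrix.trace (g ^ 2) + 2 * t * Matrix.trace (M * g ^ 2) + t ^ 2 * Matrix.trace ((M * g) ^ 2) := by
  simp only [sq, Matrix.add_mul, Matrix.mul_add, Matrix.one_mul, Matrix.smul_mul, Matrix.mul_smul,
    Matrix.trace_add, Matrix.trace_smul, smul_eq_mul, Matrix.mul_assoc]
  rw [Matrix.trace_mul_comm g (M * g), Matrix.mul_assoc]
  ring

/-- With `t = 2s` (`ℓ = 2`, `s = 2^{r-1}`): if `tr(((1 + 2sM)g)²) = tr(g²)` — i.e. the traces of `ρ₁(σ²)`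
and `ρ₂(σ²)` agree, which together with `tr ρ₁(σ) = tr ρ₂(σ)` is equality of the first two
characteristic-polynomial coefficients — then `4s·(tr(M g²) + s·tr((Mg)²)) = 0`. [folklore] -/
theorem four_mul_mul_eq_zero_of_trace_sq_eq (s : R) (M g : Matrix n n R)
    (h : Matrix.trace (((1 + (2 * s) • M) * g) ^ 2) = Matrix.trace (g ^ 2)) :
    4 * s * (Matrix.trace (M * g ^ 2) + s * Matrix.trace ((M * g) ^ 2)) = 0 := by
  rw [trace_sq_one_add_smul_mul] at h
  linear_combination h

/-- … hence, when `4s` is not a zero divisor (e.g. in `ℤ₂` with `s = 2^{r-1}`),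
`tr(M g²) + s·tr((Mg)²) = 0`. [folklore] -/
theorem trace_mul_sq_add_eq_zero_of_trace_sq_eq [NoZeroDivisors R] {s : R} (hs : (4 : R) * s ≠ 0)
    (M g : Matrix n n R) (h : Matrix.trace (((1 + (2 * s) • M) * g) ^ 2) = Matrix.trace (g ^ 2)) :
    Matrix.trace (M * g ^ 2) + s * Matrix.trace ((M * g) ^ 2) = 0 :=
  (mul_eq_zero.mp (four_mul_mul_eq_zero_of_trace_sq_eq s M g h)).resolve_left hs

/-- The residual form over `𝔽₂` (reduce the previous identity mod `2`; `a = M mod 2 = μ(σ)`,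
`g = ρ̄(σ)`, `s̄ = 2^{r-1} mod 2`): if `tr(a g²) + s̄·tr((ag)²) = 0` and `σ` is not obstructing
(`utr φ_μ(σ) = tr(a g) = 0`), then `utr₂(σ) := tr(a g²) = 0`, because `tr(X²) = (tr X)²` over `𝔽₂`
(`ZMod.trace_pow_card`).  Contrapositive = the second-coefficient witness test: an element `σ` with
`tr(μ(σ)ρ̄(σ)) = 0` but `tr(μ(σ)ρ̄(σ)²) ≠ 0` contradicts equality of the characteristic polynomials of
`ρ₁(σ), ρ₂(σ)`; for `σ = Frob_p` in `GSp₄` with equal multipliers that is equality of the Euler factors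
at `p` (`a_p` AND `b_p`).  New information exactly when `ρ̄(σ)` has order `4, 5` or `6`. [folklore] -/
theorem trace_mul_sq_eq_zero_of_residual (s : ZMod 2) (a g : Matrix n n (ZMod 2))
    (hutr : Matrix.trace (a * g) = 0)
    (h : Matrix.trace (a * g ^ 2) + s * Matrix.trace ((a * g) ^ 2) = 0) :
    Matrix.trace (a * g ^ 2) = 0 := by
  rw [ZMod.trace_pow_card (p := 2) (a * g), hutr, zero_pow two_ne_zero, mul_zero, add_zero] at h
  exact h

end SecondCoefficient

section Involution

variable {n : Type*} [Fintype n] [DecidableEq n] {R : Type*} [CommRing R]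

/-- An involution `M` (`M² = 1`) that is a similitude of an invertible form `J` with multiplier `-1`
(`Mᵀ J M = -J`, i.e. `IsSimilitude J (-1) M` of `Literature.NumberTheory.GaloisRepresentations`) has
`2 · tr M = 0`: from `Mᵀ J M = -J` and `Mᵀ Mᵀ = 1` one gets `J M = -Mᵀ J`, so `M = -J⁻¹ Mᵀ J` and
`tr M = -tr Mᵀ = -tr M`.  (For `GSp₄`: the eigenvalues of such an `M` are `1, 1, -1, -1`.)  Use: complex
conjugation `c` under an ODD symplectic Galois representation (multiplier `ν(c) = -1`, e.g. `ν` cyclotomic)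
has trace `0` on BOTH sides of a Faltings–Serre comparison, so `c` may join the test set `T` of
[BPPTVY, Algorithm 2.4.1] with its `traces` obligation discharged for free. [folklore] -/
theorem two_mul_trace_eq_zero_of_involutive_similitude_neg (J M : Matrix n n R) (hJ : IsUnit J.det)
    (hM : M * M = 1) (h : Mᵀ * J * M = -J) : 2 * M.trace = 0 := by
  have e1 : Mᵀ * Mᵀ = 1 := by rw [← Matrix.transpose_mul, hM, Matrix.transpose_one]
  have e2 : J * M = -(Mᵀ * J) := by
    have h' : Mᵀ * (Mᵀ * J * M) = Mᵀ * (-J) := by rw [h]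
    rw [← Matrix.mul_assoc, ← Matrix.mul_assoc, e1, Matrix.one_mul, Matrix.mul_neg] at h'
    exact h'
  have e3 : M = -(J⁻¹ * Mᵀ * J) := by
    have h' : J⁻¹ * (J * M) = J⁻¹ * (-(Mᵀ * J)) := by rw [e2]
    rw [← Matrix.mul_assoc, Matrix.nonsing_inv_mul J hJ, Matrix.one_mul, Matrix.mul_neg,
      ← Matrix.mul_assoc] at h'
    exact h'
  have e4 : M.trace = -M.trace := by
    conv_lhs => rw [e3]
    rw [Matrix.trace_neg, Matrix.mul_assoc, Matrix.trace_mul_comm, Matrix.mul_assoc,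
      Matrix.mul_nonsing_inv J hJ, Matrix.mul_one, Matrix.trace_transpose]
  rw [two_mul]
  nth_rewrite 1 [e4]
  exact neg_add_cancel _

/-- Over a ring in which `2` is not a zero divisor (e.g. `ℤ_ℓ`, any `ℓ`), an involutive similitude with
multiplier `-1` has trace `0`. [folklore] -/
theorem trace_eq_zero_of_involutive_similitude_neg [NoZeroDivisors R] (h2 : (2 : R) ≠ 0)
    (J M : Matrix n n R) (hJ : IsUnit J.det) (hM : M * M = 1) (h : Mᵀ * J * M = -J) : M.trace = 0 :=
  (mul_eq_zero.mp (two_mul_trace_eq_zero_of_involutive_similitude_neg J M hJ hM h)).resolve_left h2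

/-- Hence two involutive similitudes with multiplier `-1` of the same invertible form have EQUAL traces
(both `0`): the `traces` binder of the Faltings–Serre criterion (`Criterion.lean`) at a complex conjugation
costs nothing when both representations are odd with the same multiplier. [folklore] -/
theorem trace_eq_trace_of_involutive_similitude_neg [NoZeroDivisors R] (h2 : (2 : R) ≠ 0)
    (J M₁ M₂ : Matrix n n R) (hJ : IsUnit J.det) (h₁ : M₁ * M₁ = 1) (h₁' : M₁ᵀ * J * M₁ = -J)
    (h₂ : M₂ * M₂ = 1) (h₂' : M₂ᵀ * J * M₂ = -J) : M₁.trace = M₂.trace := by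
  rw [trace_eq_zero_of_involutive_similitude_neg h2 J M₁ hJ h₁ h₁',
    trace_eq_zero_of_involutive_similitude_neg h2 J M₂ hJ h₂ h₂']

end Involution

end Literature.NumberTheory.FaltingsSerre
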